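import Summits.BirchSwinnertonDyer.BirchSwinnertonDyer.Theorems.SmallImageMuTransferMuTransferX9SelmerDualLocalFineNil
import Summits.BirchSwinnertonDyer.BirchSwinnertonDyer.Theorems.SmallImageMuTransferMuTransferX9StepFourReciprocitySeams
import Summits.BirchSwinnertonDyer.Rank1Residual.X11b.LocalTrivialityBridge
import Literature.NumberTheory.GaloisRepresentations.ContinuousCorestrictionResMackey
import Literature.NumberTheory.EllipticCurves.IwasawaTwistModPTowerEmbed
import HarnessLib

/-!
# K6 crux `MuTransferX9` (stmt-BirchSwinnertonDyer-19276), stub `stub_selmerDualOdd` (skeleton v6),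
# local condition at `p`, part 4: ASSEMBLY of (L-p) from total ramification and the local embed kernel

Cell `bsd-smallim`, seat `bsd-smallim-k6-c2` (gen 3). HONEST FRAMING: theorems only; nothing asserted about any
curve, nothing booked. Architecture (Lp-5) of the seat's NOTES: the hypothesis `hLp` of
`SelmerDual.stub_selmerDualOdd_of_local` (p456301) at ONE place `v ∣ p`, from two local inputs taken as
hypotheses here (targets (Lp-2) TOTAL RAMIFICATION and (Lp-3) LOCAL MULTI-STEP EMBED KERNEL of STATUS l.298,
in the hands of seat `k6-lur-b`):

* `localization_eq_zero_of_resSubgroup_eq_zero` — a class dying on the decomposition group `D_v ≤ Γ_K`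
  (`ContinuousCorestriction.resSubgroup`) has `loc_v = 0` (`galoisCohomology.localization`; X11b
  `LocBridge.map_oneCocycleClass_eq_zero_iff`: `D_v` is the range of `Γ_{K_v} → Γ_K`).
* `resLe_cohomologyMap_eq_zero` — `res_H c = 0 ⟹ res_H (H¹(f) c) = 0` for a morphism of representations `f`.
* `localP_of` — **(L-p) at a place `v ∣ p`, from (Lp-2) `hsurj` and (Lp-3) `h3`.**  Chain (MU-TRANSFER-PROOF
  §5 STEP 1 at `p`): `Y = Sh⁻¹ y_n = cor(y_n · T⁰)` (k6-ty `coresShapiro_twistModPH1Equiv`),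
  `T^ε Y = Sh⁻¹((conj_γ − 1)^{[ε]} y_n)` (k6-c2 `coresShapiro_invTwist_iterate_conj_sub`), `(conj_γ − 1)^{[ε]} y_n`
  dies on `D_v ∩ Gal(K̄/K_n)` uniformly in `n` for FINE `y` (part 3 `exists_uniform_local_exponent_resLe`), the
  one-double-coset Mackey formula at the totally ramified `v` (`resSubgroup_cores_eq_zero_of_resLe_eq_zero`)
  gives `res_{D_v}(T^ε Y) = 0`, hence `loc_v(T^ε Y) = 0`, hence `loc_v(ι(T^ε Ψ)) = loc_v(T^{ε+k} Y) = 0`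
  (`shiftH1_iterate_map_shiftEmbed`, x10 `StepFour.localization_iterate_shiftH1`), hence by (Lp-3)
  `loc_v(T^{ε+e} Ψ) = 0`, and `loc_v(T^{ε'} Ψ) = 0` for all `ε' ≥ εp := ε + e`.

PARTITION (D-0054): X9 (A4) × p ∈ {5,7} (+ X10b∧¬Surj at 3) — helper toward `stub_selmerDualOdd`; closes none.

References: HOME/koly/MU-TRANSFER-PROOF.md §5 STEP 1; J. Neukirch, A. Schmidt, K. Wingberg (2008) I §5,
(1.6.4)–(1.6.5) [NeukirchSchmidtWingberg2008]; J.-P. Serre, *Galois Cohomology* (1997) I §2.5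
[SerreGaloisCohomology1997]; R. Greenberg, LNM 1716 (1999) §3 [GreenbergLNM1716].
-/

set_option linter.dupNamespace false
set_option autoImplicit false

noncomputable section

open scoped NumberField
open Field IsDedekindDomain Function CategoryTheory
open WeierstrassCurve (geomTorsion geomPrimaryTorsion geomTorsion_le_geomPrimaryTorsion)
open Literature.NumberTheory.GaloisRepresentations
open Literature.NumberTheory.EllipticCurves
open Literature.NumberTheory.EllipticCurves.GreenbergSelmer
open Summit.BirchSwinnertonDyer.Rank1Residual.X11b

universe u

namespace Summit.BirchSwinnertonDyer.BirchSwinnertonDyer.Rank1Residual.SelmerDual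

/-! ## From the decomposition group to the localisation -/

section Bridge

variable {K : Type u} [Field K] [NumberField K] {M : Type u} [AddCommGroup M] [TopologicalSpace M]
  [DiscreteTopology M] (ρ : DiscreteGaloisModule K M) (v : HeightOneSpectrum (𝓞 K))

/-- **A class dying on `D_v` localises to `0` at `v`**: `res_{D_v} c = 0` (subgroup restriction of
`ContinuousCorestriction`) implies `loc_v c = 0` in `H¹(K_v, M)`; both mean that a representing cocycle is
principal on `D_v = range(Γ_{K_v} → Γ_K)`. [cite: SerreGaloisCohomology1997, I §2.4–2.5] -/
theorem localization_eq_zero_of_resSubgroup_eq_zero (c : galoisCohomology ρ 1)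
    (h : resSubgroup ρ.toTopRep (decomp v) 1 c = 0) :
    galoisCohomology.localization ρ (Sum.inr v) 1 c = 0 := by
  obtain ⟨φ, rfl⟩ := oneCocycleClass_surjective _ c
  obtain ⟨x, hx⟩ := (LocBridge.map_oneCocycleClass_eq_zero_iff ρ.toTopRep
    (subgroupRep ρ.toTopRep (decomp v)) (subgroupSubtypeHom (decomp v))
    (TopRep.ofHom ⟨ContinuousLinearMap.id ℤ M, fun _ => rfl⟩) Function.bijective_id φ).1 h
  change (ContinuousCohomology.map (absGaloisRestrict K (v.adicCompletion K)) (X := ρ.toTopRep)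
    (Y := DiscreteGaloisModule.toTopRep (ContinuousRep.restrict ρ (absGaloisRestrict K (v.adicCompletion K))))
    (TopRep.ofHom ⟨ContinuousLinearMap.id ℤ M, fun _ => rfl⟩) 1).hom (oneCocycleClass _ φ) = 0
  exact (LocBridge.map_oneCocycleClass_eq_zero_iff ρ.toTopRep _ (absGaloisRestrict K (v.adicCompletion K))
    (TopRep.ofHom ⟨ContinuousLinearMap.id ℤ M, fun _ => rfl⟩) Function.bijective_id φ).2
    ⟨x, fun l => hx ⟨absGaloisRestrict K (v.adicCompletion K) l, ⟨l, rfl⟩⟩⟩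

end Bridge

section Coeff

variable {K : Type u} [Field K] {M₁ M₂ : Type u} [AddCommGroup M₁] [TopologicalSpace M₁] [DiscreteTopology M₁]
  [AddCommGroup M₂] [TopologicalSpace M₂] [DiscreteTopology M₂]
  (ρ₁ : DiscreteGaloisModule K M₁) (ρ₂ : DiscreteGaloisModule K M₂) {H H' : Subgroup (absoluteGaloisGroup K)}

/-- `res_H c = 0 ⟹ res_H (H¹(f) c) = 0` for a morphism `f` of the restrictions to `H'` of two discrete
Galois modules and `H ≤ H'`: a cocycle principal on `H`, `φ(d) = d·x − x`, maps to `f(φ(d)) = d·f(x) − f(x)`.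
[cite: NeukirchSchmidtWingberg2008, I §5] -/
theorem resLe_cohomologyMap_eq_zero (h : H ≤ H') (f : subgroupRep ρ₁.toTopRep H' ⟶ subgroupRep ρ₂.toTopRep H')
    (c : continuousCohomology 1 (subgroupRep ρ₁.toTopRep H')) (hc : resLe ρ₁.toTopRep h 1 c = 0) :
    resLe ρ₂.toTopRep h 1 (cohomologyMap f 1 c) = 0 := by
  obtain ⟨φ, rfl⟩ := oneCocycleClass_surjective _ c
  rw [resLe_oneCocycleClass, oneCocycleClass_eq_zero_iff] at hc
  obtain ⟨x, hx⟩ := hc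
  rw [cohomologyMap_oneCocycleClass, resLe_oneCocycleClass, oneCocycleClass_eq_zero_iff]
  refine ⟨f.hom x, fun d => ?_⟩
  have h1 := hx d
  rw [contOneCocycles.pullback_apply, TopRep.hom_ofHom] at h1 ⊢
  change f.hom (φ.1 (subgroupInclusion h d)) = _
  change φ.1 (subgroupInclusion h d) = _ at h1
  rw [h1, map_sub]
  congr 1
  exact TopRep.hom_comm_apply f (subgroupInclusion h d) x

end Coeff

/-! ## (L-p) at a place above `p`, assembled -/

section LocalP

variable (W : WeierstrassCurve ℚ) [W.IsElliptic] {p : ℕ} [hp : Fact p.Prime] (κ : ZpExtension ℚ p)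
  (v : HeightOneSpectrum (𝓞 ℚ))

omit [W.IsElliptic] in
/-- Transport of the local Kummer-kernel membership along `Gal(K̄/K_∞)(κ⁻¹) = Gal(K̄/K_∞)(κ)`: if the
restriction of `y ∈ H¹(K_∞, E[p])` to `D_v ∩ Gal(K̄/K_∞)` (computed for `κ`) lies in the kernel of
`H¹(·, E[p]) → H¹(·, E[p^∞])`, so does the restriction of its avatar `res y` for `κ⁻¹`.
[cite: GreenbergLNM1716, §3 Lemma 3.1] -/
theorem mem_ker_localTorsionToPrimary_invTwist (y : subgroupH1 κ.kerSubgroup (geomTorsion W (p : ℤ)))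
    (hy : resH1Hom (decompInToH κ.kerSubgroup v) (AddMonoidHom.id (geomTorsion W (p : ℤ))) (fun _ _ => rfl) y ∈
      (resH1Hom (ContinuousMonoidHom.id (decompIn κ.kerSubgroup v))
        (AddSubgroup.inclusion (geomTorsion_le_geomPrimaryTorsion W p)) (fun _ _ => rfl) :
          subgroupH1 (decompIn κ.kerSubgroup v) (geomTorsion W (p : ℤ)) →+
            subgroupH1 (decompIn κ.kerSubgroup v) (geomPrimaryTorsion W p)).ker) :
    resH1Hom (decompInToH κ.invTwist.kerSubgroup v) (AddMonoidHom.id (geomTorsion W (p : ℤ))) (fun _ _ => rfl)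
        (resOfLe (geomTorsion W (p : ℤ)) (κ.kerSubgroup_unitTwist (-1)).le y) ∈
      (resH1Hom (ContinuousMonoidHom.id (decompIn κ.invTwist.kerSubgroup v))
        (AddSubgroup.inclusion (geomTorsion_le_geomPrimaryTorsion W p)) (fun _ _ => rfl) :
          subgroupH1 (decompIn κ.invTwist.kerSubgroup v) (geomTorsion W (p : ℤ)) →+
            subgroupH1 (decompIn κ.invTwist.kerSubgroup v) (geomPrimaryTorsion W p)).ker := by
  have h := decompIn_mono v (κ.kerSubgroup_unitTwist (-1)).le
  rw [← resOfLe_decompIn_resH1Hom_decompInToH v (κ.kerSubgroup_unitTwist (-1)).le y, AddMonoidHom.mem_ker]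
  rw [AddMonoidHom.mem_ker] at hy
  -- `ι ∘ res_h = res_h ∘ ι` on `H¹(decompIn κ.kerSubgroup v, ·)`
  have hnat : ∀ b : subgroupH1 (decompIn κ.kerSubgroup v) (geomTorsion W (p : ℤ)),
      resH1Hom (ContinuousMonoidHom.id (decompIn κ.invTwist.kerSubgroup v))
          (AddSubgroup.inclusion (geomTorsion_le_geomPrimaryTorsion W p)) (fun _ _ => rfl)
          (resOfLe (geomTorsion W (p : ℤ)) h b) =
        resOfLe (geomPrimaryTorsion W p) h
          (resH1Hom (ContinuousMonoidHom.id (decompIn κ.kerSubgroup v))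
            (AddSubgroup.inclusion (geomTorsion_le_geomPrimaryTorsion W p)) (fun _ _ => rfl) b) := fun b => by
    rw [resOfLe, resOfLe, ← AddMonoidHom.comp_apply, resH1Hom_comp, ← AddMonoidHom.comp_apply, resH1Hom_comp]
    exact DFunLike.congr_fun (resH1Hom_congr (ContinuousMonoidHom.ext fun _ => rfl)
      (AddMonoidHom.ext fun _ => rfl) _ _) b
  rw [hnat, hy, map_zero]

/-- **(L-p) at a place `v ∣ p`, assembled from (Lp-2) and (Lp-3).**  Hypotheses: `p ≠ 2`, `γ` a
topological generator of `κ`; (Lp-2) `hsurj`: every coset of `Gal(ℚ̄/ℚ_∞)` meets `D_v` (total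
ramification of `v` in `ℚ_∞`); (Lp-3) `h3`: a uniform exponent `e` such that `loc_v(ι Ψ') = 0` forces
`loc_v(T^e Ψ') = 0` for the tower embeddings `ι : 𝒯_J ↪ 𝒯_L` of the dual twist.  Conclusion: the body of
the hypothesis `hLp` of `SelmerDual.stub_selmerDualOdd_of_local` at this `v`, with `εp := ε + e`, `ε` the
uniform local exponent of part 3. [cite: GreenbergLNM1716, §3] [cite: NeukirchSchmidtWingberg2008, I §5] -/
theorem localP_of (hp2 : p ≠ 2) {γ : absoluteGaloisGroup ℚ} (hγ : κ.IsTopGenerator γ)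
    (hv : ((p : ℕ) : 𝓞 ℚ) ∈ v.asIdeal)
    (hsurj : ∀ g : absoluteGaloisGroup ℚ, ∃ d ∈ decomp v, d⁻¹ * g ∈ κ.kerSubgroup)
    (h3 : ∃ e : ℕ, ∀ {J L : ℕ} (hJL : J ≤ L) (c : galoisCohomology (W.modPTwist p κ.invTwist J) 1),
      galoisCohomology.localization (W.modPTwist p κ.invTwist L) (Sum.inr v) 1
          (galoisCohomology.map (κ.invTwist.twistModPShiftEmbed (W.torsionGaloisModule (p : ℤ))
            (fun P : geomTorsion W (p : ℤ) => AddSubgroup.torsionBy.nsmul P) L hJL) 1 c) = 0 →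
        galoisCohomology.localization (W.modPTwist p κ.invTwist J) (Sum.inr v) 1
          ((κ.invTwist.shiftH1 (W.torsionGaloisModule (p : ℤ))
            (fun P : geomTorsion W (p : ℤ) => AddSubgroup.torsionBy.nsmul P) J)^[e] c) = 0) :
    ∃ εp : ℕ, ∀ (J n : ℕ) (hJn : J + 1 ≤ p ^ n)
      (y : subgroupH1 κ.kerSubgroup (geomTorsion W (p : ℤ))),
      W.torsionToPrimaryH1Sub p κ.kerSubgroup y ∈ W.fineSelmerInfty κ →
      ∀ (yn : subgroupH1 (κ.invTwist.layerSubgroup n) (geomTorsion W (p : ℤ)))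
        (Y : galoisCohomology (W.modPTwist p κ.invTwist (p ^ n)) 1)
        (Ψ : galoisCohomology (W.modPTwist p κ.invTwist (J + 1)) 1) (k : ℕ),
        resOfLe (geomTorsion W (p : ℤ)) (κ.invTwist.kerSubgroup_le_layerSubgroup n) yn =
          resOfLe (geomTorsion W (p : ℤ)) (κ.kerSubgroup_unitTwist (-1)).le y →
        κ.invTwist.twistModPH1Equiv (W.torsionGaloisModule (p : ℤ))
          (fun P : geomTorsion W (p : ℤ) => AddSubgroup.torsionBy.nsmul P) n Y = yn →
        galoisCohomology.map (κ.invTwist.twistModPShiftEmbed (W.torsionGaloisModule (p : ℤ))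
          (fun P : geomTorsion W (p : ℤ) => AddSubgroup.torsionBy.nsmul P) (p ^ n) hJn) 1 Ψ =
          (κ.invTwist.shiftH1 (W.torsionGaloisModule (p : ℤ))
            (fun P : geomTorsion W (p : ℤ) => AddSubgroup.torsionBy.nsmul P) (p ^ n))^[k] Y →
        ∀ ε' : ℕ, εp ≤ ε' →
          galoisCohomology.localization (W.modPTwist p κ.invTwist (J + 1)) (Sum.inr v) 1
            ((κ.invTwist.shiftH1 (W.torsionGaloisModule (p : ℤ))
              (fun P : geomTorsion W (p : ℤ) => AddSubgroup.torsionBy.nsmul P) (J + 1))^[ε'] Ψ) = 0 := by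
  -- a topological generator of `κ⁻¹` inside `D_v`, and total ramification for `κ⁻¹`
  obtain ⟨d₀, hd₀D, hd₀γ⟩ := hsurj γ
  have hκd₀ : κ d₀ = Multiplicative.ofAdd 1 := by
    have h1 : κ (d₀⁻¹ * γ) = 1 := hd₀γ
    rw [map_mul, map_inv, inv_mul_eq_one] at h1
    exact h1 ▸ hγ
  have hγt : κ.invTwist.IsTopGenerator d₀⁻¹ := by
    unfold ZpExtension.IsTopGenerator
    apply Multiplicative.toAdd.injective
    rw [ZpExtension.toAdd_invTwist_apply, map_inv, toAdd_inv, neg_neg, hκd₀]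
  have hγtD : d₀⁻¹ ∈ decomp v := inv_mem hd₀D
  have hker : κ.invTwist.kerSubgroup = κ.kerSubgroup := κ.kerSubgroup_unitTwist (-1)
  have hsurj' : ∀ g : absoluteGaloisGroup ℚ, ∃ d ∈ decomp v, d⁻¹ * g ∈ κ.invTwist.kerSubgroup := by
    rw [hker]; exact hsurj
  -- the uniform local exponent `ε` of part 3 and the embed-kernel exponent `e` of (Lp-3)
  obtain ⟨ε, hε⟩ := exists_uniform_local_exponent_resLe W κ.invTwist v hp2 hγt hγtD hsurj' γ
  obtain ⟨e, he⟩ := h3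
  refine ⟨ε + e, fun J n hJn y hyfine yn Y Ψ k hyn hYyn hΨ ε' hε' => ?_⟩
  -- (i) `(conj_γ − 1)^{[ε]} y_n` dies on `D_v ∩ Gal(ℚ̄/ℚ_n)`
  have hfine' := mem_ker_localTorsionToPrimary_invTwist W κ v y
    (resH1Hom_decompInToH_mem_ker_of_mem_fineSelmerInfty W p κ v hv hyfine)
  rw [← hyn] at hfine'
  have hres := hε n yn hfine'
  -- (ii) Shapiro: `Y = Sh⁻¹ y_n`, `T^ε Y = Sh⁻¹((conj_γ − 1)^{[ε]} y_n)`
  haveI : CompactSpace (absoluteGaloisGroup ℚ) := absoluteGaloisGroup_compactSpace ℚ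
  letI : Fintype (absoluteGaloisGroup ℚ ⧸ κ.invTwist.layerSubgroup n) := κ.invTwist.fintypeQuotientLayer n
  have hY : Y = κ.invTwist.coresShapiro (W.torsionGaloisModule (p : ℤ))
      (fun P : geomTorsion W (p : ℤ) => AddSubgroup.torsionBy.nsmul P) n yn := by
    rw [← hYyn]
    exact (κ.invTwist.coresShapiro_twistModPH1Equiv (W.torsionGaloisModule (p : ℤ)) _ n Y).symm
  have hTY : (κ.invTwist.shiftH1 (W.torsionGaloisModule (p : ℤ))
      (fun P : geomTorsion W (p : ℤ) => AddSubgroup.torsionBy.nsmul P) (p ^ n))^[ε] Y =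
      κ.invTwist.coresShapiro (W.torsionGaloisModule (p : ℤ))
        (fun P : geomTorsion W (p : ℤ) => AddSubgroup.torsionBy.nsmul P) n
        ((⇑(conjH1 (κ.invTwist.layerSubgroup n) (geomTorsion W (p : ℤ)) γ -
          AddMonoidHom.id (subgroupH1 (κ.invTwist.layerSubgroup n) (geomTorsion W (p : ℤ)))))^[ε] yn) := by
    rw [hY]
    exact (coresShapiro_invTwist_iterate_conj_sub κ n W hγ ε yn).symm
  -- (iii) Mackey at the totally ramified `v`: `res_{D_v}(T^ε Y) = 0`
  have hDN : ∀ g : absoluteGaloisGroup ℚ, ∃ d ∈ decomp v, d⁻¹ * g ∈ κ.invTwist.layerSubgroup n :=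
    fun g => by
    obtain ⟨d, hd, hdg⟩ := hsurj' g
    exact ⟨d, hd, κ.invTwist.kerSubgroup_le_layerSubgroup n hdg⟩
  have hopen : IsOpen (((decomp v ⊓ κ.invTwist.layerSubgroup n).subgroupOf (decomp v) :
      Subgroup (decomp v)) : Set (decomp v)) := by
    have hset : (((decomp v ⊓ κ.invTwist.layerSubgroup n).subgroupOf (decomp v) : Subgroup (decomp v)) :
        Set (decomp v)) = Subtype.val ⁻¹' (κ.invTwist.layerSubgroup n : Set (absoluteGaloisGroup ℚ)) := by
      ext x
      simp only [SetLike.mem_coe, Subgroup.mem_subgroupOf, Subgroup.mem_inf, Set.mem_preimage]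
      exact ⟨fun h => h.2, fun h => ⟨x.2, h⟩⟩
    rw [hset]
    exact (κ.invTwist.isOpen_layerSubgroup n).preimage continuous_subtype_val
  haveI : (κ.invTwist.layerSubgroup n).FiniteIndex :=
    ⟨by rw [κ.invTwist.index_layerSubgroup n]; exact pow_ne_zero _ hp.out.ne_zero⟩
  haveI : ((decomp v ⊓ κ.invTwist.layerSubgroup n).subgroupOf (decomp v)).FiniteIndex := by
    rw [Subgroup.inf_subgroupOf_left]; infer_instance
  letI : Fintype (decomp v ⧸ (decomp v ⊓ κ.invTwist.layerSubgroup n).subgroupOf (decomp v)) :=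
    Fintype.ofFinite _
  have hM0 : resSubgroup (κ.invTwist.twistModP (W.torsionGaloisModule (p : ℤ))
      (fun P : geomTorsion W (p : ℤ) => AddSubgroup.torsionBy.nsmul P) (p ^ n)).toTopRep (decomp v) 1
      ((κ.invTwist.shiftH1 (W.torsionGaloisModule (p : ℤ))
        (fun P : geomTorsion W (p : ℤ) => AddSubgroup.torsionBy.nsmul P) (p ^ n))^[ε] Y) = 0 := by
    rw [hTY]
    exact resSubgroup_cores_eq_zero_of_resLe_eq_zero _ (decomp v) (κ.invTwist.isOpen_layerSubgroup n)
      hDN hopen (resLe_cohomologyMap_eq_zero (W.torsionGaloisModule (p : ℤ)) _ inf_le_right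
        (κ.invTwist.unitCoeffHom (W.torsionGaloisModule (p : ℤ))
          (fun P : geomTorsion W (p : ℤ) => AddSubgroup.torsionBy.nsmul P) n) _ hres)
  -- (iv) localisation at `v`
  have hloc0 := localization_eq_zero_of_resSubgroup_eq_zero _ v _ hM0
  -- (v) the avatar `Ψ`: `ι(T^ε Ψ) = T^k (T^ε Y)`
  have hemb : galoisCohomology.map (κ.invTwist.twistModPShiftEmbed (W.torsionGaloisModule (p : ℤ))
      (fun P : geomTorsion W (p : ℤ) => AddSubgroup.torsionBy.nsmul P) (p ^ n) hJn) 1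
      ((κ.invTwist.shiftH1 (W.torsionGaloisModule (p : ℤ))
        (fun P : geomTorsion W (p : ℤ) => AddSubgroup.torsionBy.nsmul P) (J + 1))^[ε] Ψ) =
      (κ.invTwist.shiftH1 (W.torsionGaloisModule (p : ℤ))
        (fun P : geomTorsion W (p : ℤ) => AddSubgroup.torsionBy.nsmul P) (p ^ n))^[k]
        ((κ.invTwist.shiftH1 (W.torsionGaloisModule (p : ℤ))
          (fun P : geomTorsion W (p : ℤ) => AddSubgroup.torsionBy.nsmul P) (p ^ n))^[ε] Y) := by
    rw [← κ.invTwist.shiftH1_iterate_map_shiftEmbed (W.torsionGaloisModule (p : ℤ)) _ hJn ε Ψ, hΨ,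
      ← iterate_add_apply, ← iterate_add_apply, add_comm]
  have hloc1 : galoisCohomology.localization (W.modPTwist p κ.invTwist (p ^ n)) (Sum.inr v) 1
      (galoisCohomology.map (κ.invTwist.twistModPShiftEmbed (W.torsionGaloisModule (p : ℤ))
        (fun P : geomTorsion W (p : ℤ) => AddSubgroup.torsionBy.nsmul P) (p ^ n) hJn) 1
        ((κ.invTwist.shiftH1 (W.torsionGaloisModule (p : ℤ))
          (fun P : geomTorsion W (p : ℤ) => AddSubgroup.torsionBy.nsmul P) (J + 1))^[ε] Ψ)) = 0 := by
    rw [hemb]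
    change galoisCohomology.localization (κ.invTwist.twistModP (W.torsionGaloisModule (p : ℤ))
      (fun P : geomTorsion W (p : ℤ) => AddSubgroup.torsionBy.nsmul P) (p ^ n)) (Sum.inr v) 1 _ = 0
    rw [StepFour.localization_iterate_shiftH1, hloc0]
    exact Function.iterate_fixed (map_zero _) _
  -- (vi) the local embed kernel (Lp-3), then more powers of `T`
  have h2 := he hJn _ hloc1
  obtain ⟨r, rfl⟩ := Nat.exists_eq_add_of_le hε'
  rw [show ε + e + r = r + (e + ε) by ring, iterate_add_apply, iterate_add_apply]
  change galoisCohomology.localization (κ.invTwist.twistModP (W.torsionGaloisModule (p : ℤ))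
    (fun P : geomTorsion W (p : ℤ) => AddSubgroup.torsionBy.nsmul P) (J + 1)) (Sum.inr v) 1 _ = 0
  rw [StepFour.localization_iterate_shiftH1]
  have h2' : galoisCohomology.localization (κ.invTwist.twistModP (W.torsionGaloisModule (p : ℤ))
      (fun P : geomTorsion W (p : ℤ) => AddSubgroup.torsionBy.nsmul P) (J + 1)) (Sum.inr v) 1
      ((κ.invTwist.shiftH1 (W.torsionGaloisModule (p : ℤ))
        (fun P : geomTorsion W (p : ℤ) => AddSubgroup.torsionBy.nsmul P) (J + 1))^[e]
        ((κ.invTwist.shiftH1 (W.torsionGaloisModule (p : ℤ))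
          (fun P : geomTorsion W (p : ℤ) => AddSubgroup.torsionBy.nsmul P) (J + 1))^[ε] Ψ)) = 0 := h2
  rw [h2']
  exact Function.iterate_fixed (map_zero _) _

end LocalP

end Summit.BirchSwinnertonDyer.BirchSwinnertonDyer.Rank1Residual.SelmerDual

end
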